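import Summits.QuantumAdvantage.AdviceFreeQNC0.PerOutputFormsFrame39
import Summits.QuantumAdvantage.AdviceFreeQNC0.SeedJuntaSlack39B
import Summits.QuantumAdvantage.AdviceFreeQNC0.BondTwistLocal
import HarnessLib

/-!
# Cell qa-qnc0, `p = 3` — AFFINE MOD₃ BELLS on the (J3) map: `(J3) ⟹ RingAffineBellsLt3`, the structured branch for affine bells
# unconditionally, and the affine dichotomy (what is left of `BondTwist3.RingAffineBellsLt3` = case (B))
# (prover qn-prover-3 g28; sequel of `PerOutputFormsFrame39` / `SeedJuntaSlack39B` / `SeedJuntaDichotomy39`)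

`BondTwist3.RingAffineBellsLt3` (`BondTwistLocal` §9, planner qa-qnc0-p1: «the bottom of the degree ladder», OPEN) asks that every affine MOD₃ bell
strategy `x ↦ ([⟨β_k, x⟩ = c_k])_k` solves the `p = 3` ring relation on `≤ θ·2^{N−1}` odd inputs.  `BlockCombJoin37` records that (J3) at `r = 3`
«contains affine bells at constant loss»; with the x-frame form of (J3) (`BlockFibre37.xframe_of_perOutputFormsHardConst`) this is now a one-line
theorem, and the structured-branch machinery of the `SeedJunta*39` files applies to affine bells VERBATIM (raw strategies, no `tGuess` offset, juntas
`supp rem_k ∖ W` without the `+2`):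

* `linVal_single` — `⟨e_k, x⟩ = [x_k]`;
* ★ `ringAffineBellsLt3_of_xframe`, ★ **`ringAffineBellsLt3_of_perOutputFormsHardConst : PerOutputFormsHardConst → RingAffineBellsLt3`** — the affine
  bell `[⟨β_k,x⟩ = c_k]` is `tGuess x k ⊕ F k (⟨β_k,x⟩, ⟨e_k,x⟩, ⟨e_{nxt k},x⟩)` with `F k (v₀,v₁,v₂) = [v₁ ≠ 0] ⊕ [v₂ ≠ 0] ⊕ [v₀ = c_k]` (`r = 3`);
* ★ `affineBells_structured` — UNCONDITIONAL: ONE `θ < 1`; for every `E, C` constants `D, n₀`; every affine bell strategy whose rows decompose as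
  `β_k = Σ_j a_{kj} s_j + rem_k` with seeds `s` graded-spread off `W` under the slack schedule `N/(log₂N)^E + (log₂N)^{2C+E}(50(j+1) + D log₂N)`,
  `3·#W ≤ N`, `#(supp rem_k ∖ W) ≤ (log₂N)^C`, wins on `≤ θ·2^{N−1}` odd inputs (`GradedSeeds38.seedJuntaHardXS_slack'` with `T k = supp rem_k ∖ W ∪ W`);
* ★ `affineBells_dichotomy` — for every `W` (`3·#W ≤ N`) and every `(β, c)`: EITHER the W-greedy decomposition of the rows under the slack schedule
  (`LinJunta39.exists_seedDecompositionOff_slack`) has a remainder with `#(supp rem_k ∖ W) > (log₂N)^C` (case (B)), OR the strategy wins on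
  `≤ θ·2^{N−1}` odd inputs;
* `ringAffineBellsLt3_of_caseB` — hence `RingAffineBellsLt3` follows from constant-loss hardness of the case-(B) families ALONE (stated at `W = ∅`:
  some greedy remainder of weight `> (log₂N)^C` under the slack schedule; hypothesis inline, no new `def`).

WHAT THIS IS NOT: `RingAffineBellsLt3` is NOT proved (case (B) = rows with a heavy generic remainder is p2's decimation side / (J-mass), open as a
tree theorem); (J3) is not proved; crux `stmt-QuantumAdvantage-22907` untouched; no ledger item (D-0168 shelf).
-/

noncomputable section

namespace Summit.QuantumAdvantage.AdviceFreeQNC0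

open Classical
open Finset
open Literature.Computability.QuantumComplexity Literature.Computability.QuantumComplexity.RingHLF
open Literature.Computability.MetaComplexity

namespace GradedSeeds38

open BlockFibre37 LinJunta39 TwistedJunta36 BondTwist3

variable {N : ℕ}

/-! ### §1 `(J3) ⟹ RingAffineBellsLt3` -/

/-- `⟨e_k, x⟩ = [x_k]`. -/
theorem linVal_single (k : Fin N) (x : Fin N → Bool) :
    linVal (fun m : Fin N => if m = k then (1 : ZMod 3) else 0) x = if x k = true then 1 else 0 := by
  unfold linVal
  rw [Finset.sum_eq_single k]
  · beta_reduce; rw [if_pos rfl]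
  · intro m _ hm; beta_reduce; rw [if_neg hm]; split_ifs <;> rfl
  · intro h; exact absurd (Finset.mem_univ _) h

/-- Hence `[⟨e_k, x⟩ ≠ 0] = x_k` (for any `Decidable` instance). -/
theorem decide_linVal_single_ne (k : Fin N) (x : Fin N → Bool)
    (inst : Decidable (linVal (fun m : Fin N => if m = k then (1 : ZMod 3) else 0) x ≠ 0)) :
    @decide _ inst = x k := by
  have h : (linVal (fun m : Fin N => if m = k then (1 : ZMod 3) else 0) x ≠ 0) ↔ x k = true := by
    rw [linVal_single]; cases x k <;> decide
  rw [Bool.eq_iff_iff, decide_eq_true_iff, h]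

/-- ★ **The x-frame form of (J3) implies `RingAffineBellsLt3`** (`r = 3`: forms `β_k, e_k, e_{nxt k}`; the table re-creates `tGuess` and cancels it). -/
theorem ringAffineBellsLt3_of_xframe
    (h : ∃ θ : ℝ, θ < 1 ∧ ∀ r : ℕ, ∃ n₀ : ℕ, ∀ N ≥ n₀,
      ∀ (ℓ : Fin N → Fin r → Fin N → ZMod 3) (F : Fin N → (Fin r → ZMod 3) → Bool),
        ((univ.filter fun x : Fin N → Bool =>
            OddZeros x ∧ RingHLF.Rel x (fun k => xor (tGuess x k) (F k (fun i => linVal (ℓ k i) x)))).card : ℝ)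
          ≤ θ * (2 : ℝ) ^ (N - 1)) :
    RingAffineBellsLt3 := by
  obtain ⟨θ, hθ, hall⟩ := h
  obtain ⟨n₀, hn₀⟩ := hall 3
  refine ⟨θ, hθ, n₀, fun N hN β c => ?_⟩
  -- forms `β_k, e_k, e_{nxt k}` and the table `[v₁ ≠ 0] ⊕ [v₂ ≠ 0] ⊕ [v₀ = c_k]`
  set ℓ : Fin N → Fin 3 → Fin N → ZMod 3 := fun k i =>
    if i.val = 0 then β k else if i.val = 1 then (fun m => if m = k then 1 else 0)
    else (fun m => if m = nxt k then 1 else 0) with hℓ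
  set F : Fin N → (Fin 3 → ZMod 3) → Bool := fun k v =>
    xor (xor (decide (v 1 ≠ 0)) (decide (v 2 ≠ 0))) (decide (v 0 = c k)) with hF
  have hx := hn₀ N hN ℓ F
  have heq : (univ.filter fun x : Fin N → Bool =>
      OddZeros x ∧ RingHLF.Rel x (fun k => xor (tGuess x k) (F k (fun i => linVal (ℓ k i) x)))) =
      univ.filter fun x : Fin N → Bool =>
        OddZeros x ∧ RingHLF.Rel x (fun k => decide ((∑ i : Fin N, if x i then β k i else 0) = c k)) := by
    refine Finset.filter_congr fun x _ => ?_
    have hfun : (fun k => xor (tGuess x k) (F k (fun i => linVal (ℓ k i) x))) =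
        fun k => decide ((∑ i : Fin N, if x i then β k i else 0) = c k) := by
      funext k
      have e0 : linVal (ℓ k 0) x = ∑ i : Fin N, if x i then β k i else 0 := rfl
      have e1 : decide (linVal (ℓ k 1) x ≠ 0) = x k := decide_linVal_single_ne k x _
      have e2 : decide (linVal (ℓ k 2) x ≠ 0) = x (nxt k) := decide_linVal_single_ne (nxt k) x _
      simp only [hF, e0, e1, e2]
      unfold tGuess
      cases x k <;> cases x (nxt k) <;> cases decide ((∑ i : Fin N, if x i then β k i else 0) = c k) <;> rfl
    rw [hfun]
  rw [heq] at hx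
  exact hx

/-- ★★ **`(J3) ⟹ RingAffineBellsLt3`**: the typed conjecture `BlockFibre37.PerOutputFormsHardConst` (any frame, by `PerOutputFormsFrame39`) contains
affine MOD₃ bells at constant loss — the remark of `BlockCombJoin37` («(J3) for `r = 3` contains affine bells») as a theorem. -/
theorem ringAffineBellsLt3_of_perOutputFormsHardConst (h : PerOutputFormsHardConst) : RingAffineBellsLt3 :=
  ringAffineBellsLt3_of_xframe (xframe_of_perOutputFormsHardConst h)

/-! ### §2 The structured branch for affine bells — unconditional -/

/-- ★ **AFFINE BELLS, STRUCTURED BRANCH — UNCONDITIONAL.**  ONE `θ < 1`; for every `E, C` constants `D, n₀`; for `N ≥ n₀`: every affine MOD₃ bell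
strategy `[⟨β_k,x⟩ = c_k]` whose rows decompose as `β_k = Σ_j a_{kj} s_j + rem_k` with seeds `s` graded-spread off `W` under the slack schedule,
`3·#W ≤ N` and `#(supp rem_k ∖ W) ≤ (log₂N)^C` (supports otherwise arbitrary) wins on `≤ θ·2^{N−1}` odd inputs.
(`seedJuntaHardXS_slack'` with `T k = (supp rem_k ∖ W) ∪ W`, `H k v x = [Σ_j a_{kj} v_j + ⟨rem_k, x⟩ = c_k]`.) -/
theorem affineBells_structured :
    ∃ θ : ℝ, θ < 1 ∧ ∀ E C : ℕ, ∃ D n₀ : ℕ, ∀ N ≥ n₀,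
      ∀ (W : Finset (Fin N)) (β : Fin N → Fin N → ZMod 3) (c : Fin N → ZMod 3)
        (R : ℕ) (s : Fin R → Fin N → ZMod 3) (a : Fin N → Fin R → ZMod 3) (rem : Fin N → Fin N → ZMod 3),
        3 * W.card ≤ N →
        (∀ k m, β k m = ∑ j, a k j * s j m + rem k m) →
        GradedSpreadOff W s (fun j =>
          N / Nat.log 2 N ^ E + (Nat.log 2 N) ^ (2 * C + E) * (50 * (j.val + 1) + D * Nat.log 2 N)) →
        (∀ k, (suppOff W (rem k)).card ≤ (Nat.log 2 N) ^ C) →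
          ((univ.filter fun x : Fin N → Bool =>
              OddZeros x ∧ RingHLF.Rel x (fun k => decide ((∑ i : Fin N, if x i then β k i else 0) = c k))).card : ℝ)
            ≤ θ * (2 : ℝ) ^ (N - 1) := by
  obtain ⟨θ, hθ, hall⟩ := seedJuntaHardXS_slack'
  refine ⟨θ, hθ, fun E C => ?_⟩
  obtain ⟨D, n₀, hD⟩ := hall E C
  refine ⟨D, n₀, fun N hN W β c R s a rem hW hdec hspread hr => ?_⟩
  set T : Fin N → Finset (Fin N) := fun k => suppOff W (rem k) ∪ W with hTdef
  have hT : ∀ k, (T k \ W).card ≤ (Nat.log 2 N) ^ C := by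
    intro k
    refine le_trans (Finset.card_le_card ?_) (hr k)
    intro m hm
    rw [Finset.mem_sdiff, hTdef, Finset.mem_union] at hm
    rcases hm.1 with h | h
    · exact h
    · exact absurd h hm.2
  have hH : ∀ k (v : Fin R → ZMod 3) (x x' : Fin N → Bool), (∀ m ∈ T k, x m = x' m) →
      decide (∑ t, a k t * v t + linVal (rem k) x = c k) = decide (∑ t, a k t * v t + linVal (rem k) x' = c k) := by
    intro k v x x' hxx'
    rw [linVal_readsOnly W (rem k) x x' fun m hm => hxx' m hm]
  have h := hD N hN W R s T (fun k v x => decide (∑ t, a k t * v t + linVal (rem k) x = c k)) hW hspread hT hH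
  have hlin : ∀ (k : Fin N) (x : Fin N → Bool),
      (∑ i : Fin N, if x i then β k i else 0) = ∑ t, a k t * LinForms.resVec s x t + linVal (rem k) x :=
    fun k x => linVal_decomp s (a k) (rem k) (β k) (hdec k) x
  have hset : (univ.filter fun x : Fin N → Bool =>
        OddZeros x ∧ RingHLF.Rel x (fun k => decide ((∑ i : Fin N, if x i then β k i else 0) = c k)))
      = univ.filter fun x : Fin N → Bool => OddZeros x ∧ RingHLF.Rel x (fun k =>
          decide (∑ t, a k t * LinForms.resVec s x t + linVal (rem k) x = c k)) := by
    refine filter_congr fun x _ => ?_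
    simp only [hlin]
  rw [hset]
  exact h

/-! ### §3 The affine dichotomy, and `RingAffineBellsLt3 ⟸ case (B)` -/

/-- ★ **THE AFFINE DICHOTOMY RELATIVE TO A TOLERANCE SET — UNCONDITIONAL.**  ONE `θ < 1`; for every `E, C` constants `D, n₀`; for `N ≥ n₀`, every
`W` with `3·#W ≤ N` and every affine bell strategy `(β, c)`: EITHER (B) the W-greedy seed decomposition of the rows under the slack schedule
(injective seeds from the family, graded-spread off `W`, `β_k = Σ_j a_{kj} β_{s j} + rem_k`, all `#(supp rem_k ∖ W) < w(R)`) has a remainder with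
`#(supp rem_k ∖ W) > (log₂N)^C`, OR (A) the strategy wins on `≤ θ·2^{N−1}` odd inputs. -/
theorem affineBells_dichotomy :
    ∃ θ : ℝ, θ < 1 ∧ ∀ E C : ℕ, ∃ D n₀ : ℕ, ∀ N ≥ n₀,
      ∀ (W : Finset (Fin N)) (β : Fin N → Fin N → ZMod 3) (c : Fin N → ZMod 3), 3 * W.card ≤ N →
        (∃ (R : ℕ) (s : Fin R → Fin N) (a : Fin N → Fin R → ZMod 3) (rem : Fin N → Fin N → ZMod 3),
          Function.Injective s ∧
          (∀ k m, β k m = ∑ j, a k j * β (s j) m + rem k m) ∧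
          GradedSpreadOff W (fun j => β (s j)) (fun j =>
            N / Nat.log 2 N ^ E + (Nat.log 2 N) ^ (2 * C + E) * (50 * (j.val + 1) + D * Nat.log 2 N)) ∧
          (∀ k, (suppOff W (rem k)).card
            < N / Nat.log 2 N ^ E + (Nat.log 2 N) ^ (2 * C + E) * (50 * (R + 1) + D * Nat.log 2 N)) ∧
          ∃ k, (Nat.log 2 N) ^ C < (suppOff W (rem k)).card)
        ∨ ((univ.filter fun x : Fin N → Bool =>
              OddZeros x ∧ RingHLF.Rel x (fun k => decide ((∑ i : Fin N, if x i then β k i else 0) = c k))).card : ℝ)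
            ≤ θ * (2 : ℝ) ^ (N - 1) := by
  obtain ⟨θ, hθ, hall⟩ := affineBells_structured
  refine ⟨θ, hθ, fun E C => ?_⟩
  obtain ⟨D, n₀, hD⟩ := hall E C
  refine ⟨D, max n₀ 2, fun N hN W β c hW => ?_⟩
  have hN0 : n₀ ≤ N := le_trans (le_max_left _ _) hN
  have hN2 : 2 ≤ N := le_trans (le_max_right _ _) hN
  obtain ⟨R, s, a, rem, hs, hspread, hdec, hrem⟩ := exists_seedDecompositionOff_slack E C D hN2 W β
  by_cases hB : ∃ k, (Nat.log 2 N) ^ C < (suppOff W (rem k)).card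
  · exact Or.inl ⟨R, s, a, rem, hs, hdec, hspread, hrem, hB⟩
  · right
    simp only [not_exists, not_lt] at hB
    exact hD N hN0 W β c R (fun j => β (s j)) a rem hW hdec hspread hB

/-- **`RingAffineBellsLt3 ⟸ case (B)`**: constant-loss hardness of the affine bell strategies whose `∅`-greedy decomposition under the slack schedule
(for SOME `E, C`, and for every `D`) leaves a remainder of weight `> (log₂N)^C` implies `RingAffineBellsLt3` (the structured families are
`affineBells_dichotomy`'s case (A) at `W = ∅`). -/
theorem ringAffineBellsLt3_of_caseB
    (hB : ∃ θB : ℝ, θB < 1 ∧ ∃ E C : ℕ, ∀ D : ℕ, ∃ n₀ : ℕ, ∀ N ≥ n₀,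
      ∀ (β : Fin N → Fin N → ZMod 3) (c : Fin N → ZMod 3),
        (∃ (R : ℕ) (s : Fin R → Fin N) (a : Fin N → Fin R → ZMod 3) (rem : Fin N → Fin N → ZMod 3),
          Function.Injective s ∧
          (∀ k m, β k m = ∑ j, a k j * β (s j) m + rem k m) ∧
          GradedSpreadOff (∅ : Finset (Fin N)) (fun j => β (s j)) (fun j =>
            N / Nat.log 2 N ^ E + (Nat.log 2 N) ^ (2 * C + E) * (50 * (j.val + 1) + D * Nat.log 2 N)) ∧
          (∀ k, (suppOff (∅ : Finset (Fin N)) (rem k)).card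
            < N / Nat.log 2 N ^ E + (Nat.log 2 N) ^ (2 * C + E) * (50 * (R + 1) + D * Nat.log 2 N)) ∧
          ∃ k, (Nat.log 2 N) ^ C < (suppOff (∅ : Finset (Fin N)) (rem k)).card) →
        ((univ.filter fun x : Fin N → Bool =>
            OddZeros x ∧ RingHLF.Rel x (fun k => decide ((∑ i : Fin N, if x i then β k i else 0) = c k))).card : ℝ)
          ≤ θB * (2 : ℝ) ^ (N - 1)) :
    RingAffineBellsLt3 := by
  obtain ⟨θB, hθB, E, C, hBall⟩ := hB
  obtain ⟨θ, hθ, hall⟩ := affineBells_dichotomy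
  obtain ⟨D, n₀, hD⟩ := hall E C
  obtain ⟨n₁, hn₁⟩ := hBall D
  refine ⟨max θ θB, max_lt hθ hθB, max n₀ n₁, fun N hN β c => ?_⟩
  have hN0 : n₀ ≤ N := le_trans (le_max_left _ _) hN
  have hN1 : n₁ ≤ N := le_trans (le_max_right _ _) hN
  have h2 : (0 : ℝ) ≤ (2 : ℝ) ^ (N - 1) := by positivity
  rcases hD N hN0 ∅ β c (by simp) with hcase | hcase
  · exact (hn₁ N hN1 β c hcase).trans (mul_le_mul_of_nonneg_right (le_max_right _ _) h2)
  · exact hcase.trans (mul_le_mul_of_nonneg_right (le_max_left _ _) h2)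

/-! ### §4 (appended) The planner's sharp x-frame target `PerOutputFormsSharpX` implies (J3) and `RingAffineBellsLt3` -/

/-- **`PerOutputFormsSharpX ⟹ (J3)`**: the sharp x-frame target of `GradedSeeds38Targets` (constant `2/3 + ε`; tables of `LinForms.resVec (ℓ k) x`,
which is `(linVal (ℓ k i) x)_i` by `rfl`) gives `BlockFibre37.PerOutputFormsHardConst` at every charge (`ε = 1/6`, x-frame `θ = 5/6`, walk `θ' = 23/24`
by `perOutputFormsHardConst_of_xframe`). -/
theorem perOutputFormsHardConst_of_sharpX (h : PerOutputFormsSharpX) : PerOutputFormsHardConst := by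
  refine perOutputFormsHardConst_of_xframe ⟨2 / 3 + 1 / 6, by norm_num, fun r => ?_⟩
  obtain ⟨n₀, hn₀⟩ := h (1 / 6) (by norm_num) r
  exact ⟨n₀, fun N hN ℓ F => hn₀ N hN ℓ F⟩

/-- **`PerOutputFormsSharpX ⟹ RingAffineBellsLt3`** (through `ringAffineBellsLt3_of_xframe`, `θ = 5/6`). -/
theorem ringAffineBellsLt3_of_sharpX (h : PerOutputFormsSharpX) : RingAffineBellsLt3 := by
  refine ringAffineBellsLt3_of_xframe ⟨2 / 3 + 1 / 6, by norm_num, fun r => ?_⟩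
  obtain ⟨n₀, hn₀⟩ := h (1 / 6) (by norm_num) r
  exact ⟨n₀, fun N hN ℓ F => hn₀ N hN ℓ F⟩

/-! ### §5 (appended) Named corollary: (J3) ⟺ (J3) at the top charge, in the walk frame -/

/-- **(J3) ⟺ (J3) at the single charge `n + 2` (walk frame)**: the composition of `BlockFibre37.perOutputFormsHardConst_of_topCharge` with the
trivial specialisation `c := n + 2` — recorded by name for `lean search`. -/
theorem _root_.Summit.QuantumAdvantage.AdviceFreeQNC0.BlockFibre37.perOutputFormsHardConst_iff_topCharge :
    PerOutputFormsHardConst ↔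
      ∃ θ : ℝ, θ < 1 ∧ ∀ r : ℕ, ∃ n₀ : ℕ, ∀ n ≥ n₀,
        ∀ (ℓ : Fin (n + 1) → Fin r → Fin (n + 1) → ZMod 3) (F : Fin (n + 1) → (Fin r → ZMod 3) → Bool),
          ((univ.filter fun u : Fin n → Bool =>
              ringWinU (n + 2) (fun g u => F g (fun i => gateSum (ℓ g i) u)) u = true).card : ℝ) ≤ θ * (2 : ℝ) ^ n := by
  refine ⟨fun h => ?_, perOutputFormsHardConst_of_topCharge⟩
  obtain ⟨θ, hθ, hall⟩ := h
  refine ⟨θ, hθ, fun r => ?_⟩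
  obtain ⟨n₀, hn₀⟩ := hall r
  exact ⟨n₀, fun n hn ℓ F => hn₀ n hn ℓ (n + 2) F⟩

end GradedSeeds38

end Summit.QuantumAdvantage.AdviceFreeQNC0

end
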